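import Summits.QuantumFields.YangMills.Theorems.IR.BlockedActivityCalibrationCells
import Summits.QuantumFields.YangMills.Theorems.IR.BlockedActivityUnivShellCond
import HarnessLib

/-!
# Crux `IR` (stmt-QuantumFields-19354), lane B: CALIBRATION of the blocked-activity class, part 2/2 — strong coupling
# BEFORE blocking instantiates the class at mesh 1, at every window

Helper module for item `stmt-QuantumFields-19354` (`--supports`; it closes nothing), lane `ym-19354-onsetsc-p2`; data and
lemmas in part 1/2 `Theorems/IR/BlockedActivityCalibrationCells`.

* `card_Pcell_le` — a mesh-1 cell (side `≤ 2`) is the base cell of at most `cellPlaqBound = 16 · #planes` kernel plaquettes;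
* `norm_cellFactor_le` — `|plaquetteObs| ≤ C`, `#Pcell ≤ K`, `K |β| (N + C) ≤ A ≤ 1` ⇒ `‖cellFactor‖ ≤ 2A`
  (`∏ e^{x_p} = e^{Σ x_p}`, `|e^s − 1| ≤ 2|s|`);
* `indep_cellSigma` — **finite-range dependence of the product Haar reference**: cell sets that do not touch
  (sup-adjacency `CellAdj`) have disjoint forward neighbourhoods, hence independent σ-algebras (Mathlib `iIndepFun_pi`,
  `indep_iSup_of_disjoint`);
* `prod_one_add_cellFactor` — `∏_{c} (1 + cellFactor c) = e^{-β S_Λ}` (the base cells partition the kernel's plaquettes);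
* `nonempty_blockedRep` — the mesh-1 Wilson data form a `BlockedRep ρ β w Y a` (the kernel integral formula
  `Tempered.integral_ymSpecification_of_continuous` is exactly the perturbed expectation `pertExpect`);
* **`blockedActivityClass_one_of_smallBeta`** — for every compact `G`, continuous `ρ`, `a > 0` there is `β_B > 0` with
  `BlockedActivityClass ρ β 1 n a` for all `|β| ≤ β_B` and EVERY window `n`
  (`β_B = min 1 (a/2) ∕ (cellPlaqBound (N + C_ρ) + 1)`);
* §6 `radius_eq`, `radiusDen_bounds` (`10⁸⁵ < 4e·2⁸¹·(2e)⁸² < 10⁸⁶`), `radius_bounds` — THE NUMBER of the reduction as citable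
  decls (owner R98 (1)), with the anatomy of the Dobrushin-exclusion waste in the docstring;
* **`univShellCond_one_of_smallBeta_allWindows`** — hence (with the lane's reduction
  `univShellCond_of_blockedActivity_radius`, p528785) `OnsetFormats.UnivShellCond ρ β 1 n ε` for `|β| ≤ β_B(a(ε))`,
  `0 < ε ≤ 1`, at EVERY window `n` — the lead's calibration `Calibration.univShellCond_one_one_of_smallBeta` (p521316) is
  the window `n = 1`; the volume-uniformity is the Kotecký–Preiss layer's.

So the lane-B picture in the kernel: the class holds at `(β small, b = 1)` [this file] and the crux asks for it at
`(β → ∞, b = b(β))` [`BlockedActivityOnsetSC`, open]; the reduction to the stub is `onsetMixingTypicalUKPcSC_of_blockedActivityOnsetSC`.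
HONEST FRAMING: strong-coupling bookkeeping; nothing about weak coupling, the gap or Clay.  No `sorry`; axioms ⊆ {propext,
Classical.choice, Quot.sound}; no instances, no notation.
Refs: SeilerLNP1982 Ch. 2; OsterwalderSeilerAnnPhys1978 §3; FriedliVelenik2017 §5.7.1; Georgii2011 Def. 2.9 ∕ Prop. 8.8.
-/

set_option autoImplicit false

noncomputable section

open MeasureTheory ProbabilityTheory
open Literature.MathematicalPhysics.QuantumFieldTheory (haarProbability)
open Literature.MathematicalPhysics.QuantumLattice
open Literature.Probability.LatticeModels (IsLocalPerturbation IsLocalObservable pertExpect pertNum pertZ Touches glueWith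
  glueWith_apply_mem glueWith_apply_not_mem measurable_glueWith)
open Summit.QuantumFields.YangMills.Cruxes.IR.Tempered (cellEdges windowCells regionEdges
  integral_ymSpecification_of_continuous)
open Summit.QuantumFields.YangMills.Cruxes.IR.CellTempered.Engine (frameIdx frameCell frameCell_eq_iff
  mem_cellEdges_frameCell frameIdx_le lt_frameIdx_succ frameIdx_eq_iff frame_add_nat_le)

open Summit.QuantumFields.YangMills.Cruxes.IR.OnsetFormats (UnivShellCond)

namespace Summit.QuantumFields.YangMills.Cruxes.IR.BlockedActivity

/-! ## §4 Counting, smallness, independence, the representation -/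

section Construction

variable {G : Type} [Group G] [TopologicalSpace G] [IsTopologicalGroup G] [CompactSpace G]
  [MeasurableSpace G] [BorelSpace G] {N : ℕ} (ρ : G →* Matrix (Fin N) (Fin N) ℂ) (β : ℝ)
  {w : Fin 4 → ℤ → ℤ} (Λ : Finset (ZdEdge 4))

/-- The plaquette count per mesh-1 cell: `16 ·` (number of planes). -/
def cellPlaqBound : ℕ := 16 * Fintype.card {q : Fin 4 × Fin 4 // q.1 < q.2}

omit [TopologicalSpace G] [IsTopologicalGroup G] [CompactSpace G] [MeasurableSpace G] [BorelSpace G] in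
/-- A mesh-1 cell is the base cell of at most `cellPlaqBound` plaquettes. -/
theorem card_Pcell_le (hw : ∀ i j, w i j + ((1 : ℕ) : ℤ) ≤ w i (j + 1) ∧ w i (j + 1) ≤ w i j + 2 * ((1 : ℕ) : ℤ))
    (c : Cell) : (Pcell w Λ c).card ≤ cellPlaqBound := by
  have hw1 : ∀ i j, w i j + 1 ≤ w i (j + 1) := fun i j => by have := (hw i j).1; push_cast at this; exact this
  set box : Finset (Fin 4 → ℤ) := Fintype.piFinset fun i => Finset.Ico (w i (c i)) (w i (c i + 1)) with hbox
  have hsub : Pcell w Λ c ⊆ box ×ˢ (Finset.univ : Finset {q : Fin 4 × Fin 4 // q.1 < q.2}) := by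
    intro p hp
    have hpc : baseCell w p = c := (Finset.mem_filter.1 hp).2
    have hmem : (p.1, p.2.1.1) ∈ cellEdges w c := (frameCell_eq_iff hw1 _ c).1 hpc
    have hx : p.1 ∈ box := (Finset.mem_product.1 hmem).1
    exact Finset.mem_product.2 ⟨hx, Finset.mem_univ _⟩
  have hboxc : box.card ≤ 16 := by
    rw [hbox, Fintype.card_piFinset]
    have h : ∀ i : Fin 4, (Finset.Ico (w i (c i)) (w i (c i + 1))).card ≤ 2 := fun i => by
      rw [Int.card_Ico]
      refine Int.toNat_le.2 ?_
      have := (hw i (c i)).2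
      push_cast at this ⊢
      omega
    have := Finset.prod_le_pow_card (Finset.univ : Finset (Fin 4))
      (fun i => (Finset.Ico (w i (c i)) (w i (c i + 1))).card) 2 fun i _ => h i
    simpa using this
  calc (Pcell w Λ c).card ≤ (box ×ˢ (Finset.univ : Finset {q : Fin 4 × Fin 4 // q.1 < q.2})).card :=
        Finset.card_le_card hsub
    _ = box.card * Fintype.card {q : Fin 4 × Fin 4 // q.1 < q.2} := by
        rw [Finset.card_product, Finset.card_univ]
    _ ≤ cellPlaqBound := Nat.mul_le_mul_right _ hboxc

omit [TopologicalSpace G] [IsTopologicalGroup G] [CompactSpace G] [MeasurableSpace G] [BorelSpace G] in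
/-- **Smallness of the cell factors**: if `|plaquetteObs| ≤ C`, `#Pcell ≤ K` and `K |β| (N + C) ≤ A ≤ 1` then
`‖cellFactor‖ ≤ 2A`. -/
theorem norm_cellFactor_le {C : ℝ} (hC : ∀ (x : Fin 4 → ℤ) (i j : Fin 4) (U : LGConfig 4 G), |plaquetteObs ρ x i j U| ≤ C)
    {K : ℕ} (hK : ∀ c, (Pcell w Λ c).card ≤ K) {A : ℝ} (hA : (K : ℝ) * (|β| * ((N : ℝ) + C)) ≤ A) (hA1 : A ≤ 1)
    (σ : LGConfig 4 G) (c : Cell) (ζ : ↥Λ → G) : ‖cellFactor ρ β w Λ σ c ζ‖ ≤ 2 * A := by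
  set U : LGConfig 4 G := glueWith Λ ζ σ
  set S : ℝ := ∑ p ∈ Pcell w Λ c, (-β * ((N : ℝ) - plaquetteObs ρ p.1 p.2.1.1 p.2.1.2 U)) with hS
  have hprod : ∏ p ∈ Pcell w Λ c, plaqWeight ρ β p U = Real.exp S := by
    rw [hS, Real.exp_sum]; rfl
  have hβ0 : 0 ≤ |β| * ((N : ℝ) + C) := by
    have : 0 ≤ C := (abs_nonneg _).trans (hC 0 0 0 U)
    positivity
  have hSle : |S| ≤ A := by
    calc |S| ≤ ∑ p ∈ Pcell w Λ c, |(-β * ((N : ℝ) - plaquetteObs ρ p.1 p.2.1.1 p.2.1.2 U))| :=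
          Finset.abs_sum_le_sum_abs _ _
      _ ≤ ∑ _p ∈ Pcell w Λ c, |β| * ((N : ℝ) + C) := Finset.sum_le_sum fun p _ => abs_log_plaqWeight_le ρ β hC p U
      _ = (Pcell w Λ c).card * (|β| * ((N : ℝ) + C)) := by rw [Finset.sum_const, nsmul_eq_mul]
      _ ≤ K * (|β| * ((N : ℝ) + C)) := by gcongr; exact hK c
      _ ≤ A := hA
  have hS1 : |S| ≤ 1 := hSle.trans hA1
  have hcf : cellFactor ρ β w Λ σ c ζ = ((Real.exp S - 1 : ℝ) : ℂ) := by
    unfold cellFactor; rw [hprod]; push_cast; ring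
  rw [hcf, Complex.norm_real, Real.norm_eq_abs]
  exact (Real.abs_exp_sub_one_le hS1).trans (by linarith)

/-- **Finite-range dependence of the product Haar reference**: non-touching cell sets generate independent
σ-algebras (their forward neighbourhoods are disjoint sets of coordinates). -/
theorem indep_cellSigma (K₁ K₂ : Finset Cell) (hK : ¬ Touches CellAdj K₁ K₂) :
    Indep (⨆ c ∈ K₁, cellSigma (G := G) w Λ c) (⨆ c ∈ K₂, cellSigma (G := G) w Λ c)
      (Measure.pi fun _ : ↥Λ => haarProbability G) := by
  classical
  have h1 : (⨆ c ∈ K₁, cellSigma (G := G) w Λ c) =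
      ⨆ e ∈ K₁.biUnion (Ecell w Λ), (‹MeasurableSpace G›).comap fun ζ : ↥Λ → G => ζ e := by
    unfold cellSigma; rw [Finset.iSup_biUnion]
  have h2 : (⨆ c ∈ K₂, cellSigma (G := G) w Λ c) =
      ⨆ e ∈ K₂.biUnion (Ecell w Λ), (‹MeasurableSpace G›).comap fun ζ : ↥Λ → G => ζ e := by
    unfold cellSigma; rw [Finset.iSup_biUnion]
  rw [h1, h2]
  have hind : iIndep (fun e : ↥Λ => (‹MeasurableSpace G›).comap fun ζ : ↥Λ → G => ζ e)
      (Measure.pi fun _ : ↥Λ => haarProbability G) :=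
    (iIndepFun_pi (μ := fun _ : ↥Λ => haarProbability G) (X := fun _ => (id : G → G))
      fun _ => aemeasurable_id).iIndep
  have hdisj : Disjoint (K₁.biUnion (Ecell w Λ)) (K₂.biUnion (Ecell w Λ)) := by
    rw [Finset.disjoint_left]
    intro e he1 he2
    obtain ⟨c₁, hc₁, he₁⟩ := Finset.mem_biUnion.1 he1
    obtain ⟨c₂, hc₂, he₂⟩ := Finset.mem_biUnion.1 he2
    exact hK ⟨c₁, hc₁, c₂, hc₂, Or.inr
      (cellAdj_of_fwd_of_fwd (Finset.mem_filter.1 he₁).2 (Finset.mem_filter.1 he₂).2)⟩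
  exact indep_iSup_of_disjoint (S := (K₁.biUnion (Ecell w Λ) : Set ↥Λ)) (T := (K₂.biUnion (Ecell w Λ) : Set ↥Λ))
    (fun e => (measurable_pi_apply e).comap_le) hind (Finset.disjoint_coe.2 hdisj)

omit [TopologicalSpace G] [IsTopologicalGroup G] [CompactSpace G] [MeasurableSpace G] [BorelSpace G] in
/-- The product of the `1 + cellFactor` over the base cells is the full Wilson tilting weight `exp(-β S_Λ)`. -/
theorem prod_one_add_cellFactor (σ : LGConfig 4 G) (ζ : ↥Λ → G) :
    ∏ c ∈ Ccells w Λ, (1 + cellFactor ρ β w Λ σ c ζ) =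
      ((Real.exp (-β * wilsonBoundaryAction ρ Λ (glueWith Λ ζ σ)) : ℝ) : ℂ) := by
  have h1 : ∀ c, 1 + cellFactor ρ β w Λ σ c ζ =
      ((∏ p ∈ Pcell w Λ c, plaqWeight ρ β p (glueWith Λ ζ σ) : ℝ) : ℂ) := fun c => by
    unfold cellFactor; ring
  simp_rw [h1]
  rw [← Complex.ofReal_prod]
  congr 1
  unfold Pcell Ccells
  rw [Finset.prod_fiberwise_of_maps_to (fun p hp => Finset.mem_image_of_mem (baseCell w) hp)]
  unfold plaqWeight wilsonBoundaryAction
  rw [Finset.mul_sum, Real.exp_sum]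

variable (hw : ∀ i j, w i j + ((1 : ℕ) : ℤ) ≤ w i (j + 1) ∧ w i (j + 1) ≤ w i j + 2 * ((1 : ℕ) : ℤ))
include hw

omit [TopologicalSpace G] [IsTopologicalGroup G] [CompactSpace G] [MeasurableSpace G] [BorelSpace G] in
/-- The lower frame bound, in the form used by the frame-cell lemmas. -/
theorem frame_lower : ∀ i j, w i j + 1 ≤ w i (j + 1) := fun i j => by
  have := (hw i j).1; push_cast at this; exact this

/-- **The mesh-1 Wilson representation is a blocked local-perturbation representation.**  For `|plaquetteObs| ≤ C`,
`cellPlaqBound · |β| (N + C) ≤ A ≤ 1` and `2A ≤ a`: the reference is the product Haar measure on the links of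
`Λ = regionEdges w Y`, the cell σ-algebras are generated by the links of the forward neighbours, the cell factor of `c`
is `∏_{p based in c} e^{-β s_p} − 1`, and centre observables are realised by gluing. -/
theorem nonempty_blockedRep (hρ : Continuous ρ) {C : ℝ}
    (hC : ∀ (x : Fin 4 → ℤ) (i j : Fin 4) (U : LGConfig 4 G), |plaquetteObs ρ x i j U| ≤ C)
    {A a : ℝ} (hA : (cellPlaqBound : ℝ) * (|β| * ((N : ℝ) + C)) ≤ A) (hA1 : A ≤ 1) (ha : 2 * A ≤ a)
    (Y : Finset Cell) (h0 : (0 : Cell) ∈ Y) : Nonempty (BlockedRep ρ β w Y a) := by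
  have hw1 := frame_lower hw
  set Λ := regionEdges w Y with hΛ
  have hΛ0 : ∀ e ∈ cellEdges w 0, e ∈ Λ := fun e he => Finset.mem_biUnion.2 ⟨0, h0, he⟩
  have hE0 : ∀ e (he : e ∈ cellEdges w 0), (⟨e, hΛ0 e he⟩ : ↥Λ) ∈ Ecell w Λ 0 := fun e he => by
    refine Finset.mem_filter.2 ⟨Finset.mem_univ _, ?_⟩
    rw [(frameCell_eq_iff hw1 e 0).2 he]
    exact fun i => ⟨le_rfl, by simp⟩
  have ha0 : 0 ≤ a := by
    have : 0 ≤ (cellPlaqBound : ℝ) * (|β| * ((N : ℝ) + C)) := by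
      have : 0 ≤ C := (abs_nonneg _).trans (hC 0 0 0 fun _ => 1)
      positivity
    linarith
  refine ⟨{
    Ω := ↥Λ → G
    mΩ := MeasurableSpace.pi
    μ := Measure.pi fun _ : ↥Λ => haarProbability G
    isProb := inferInstance
    𝓕 := cellSigma w Λ
    C := Ccells w Λ
    g := cellFactor ρ β w Λ
    obs := obsReal Λ
    perturbation := fun σ => {
      le := cellSigma_le w Λ
      indep := indep_cellSigma Λ
      measurable := fun c => measurable_cellFactor ρ β Λ hw1 hρ σ c
      norm_le := fun c ζ => (norm_cellFactor_le ρ β Λ hC (card_Pcell_le Λ hw) hA hA1 σ c ζ).trans ha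
      nonneg := ha0 }
    obs_local := fun f hf => ?_
    local_g := fun p σ σ' h => cellFactor_local ρ β hw1 p σ σ' h
    rep := fun σ f hf => ?_ }⟩
  · -- locality and boundedness of the realised observable
    refine ⟨?_, fun ζ => ?_⟩
    · have hm : Measurable[cellSigma (G := G) w Λ 0] (obsReal Λ f) := by
        refine measurable_cellSigma_of_factor w Λ 0
          (Ft := fun ξ => ((f (glueWith Λ (ext w Λ 0 ξ) fun _ => 1) : ℝ) : ℂ)) ?_ fun ζ => ?_
        · exact Complex.measurable_ofReal.comp (hf.2.1.comp ((measurable_glueWith Λ _).comp (measurable_ext w Λ 0)))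
        · unfold obsReal
          congr 1
          refine hf.1 fun e he => ?_
          have he' : e ∈ cellEdges w 0 := he
          rw [glueWith_apply_mem _ _ _ (hΛ0 e he'), glueWith_apply_mem _ _ _ (hΛ0 e he'),
            ext_restr_apply w Λ 0 ζ (hE0 e he')]
      exact hm.mono (le_iSup₂ (f := fun (p : Cell) (_ : p ∈ ({0} : Finset Cell)) => cellSigma (G := G) w Λ p) 0
        (Finset.mem_singleton_self 0)) le_rfl
    · unfold obsReal
      rw [Complex.norm_real, Real.norm_eq_abs]
      obtain ⟨h0f, h1f⟩ := hf.2.2 (glueWith Λ ζ fun _ => 1)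
      rw [abs_of_nonneg h0f]; exact h1f
  · -- the representation: tilted product Haar = perturbed expectation
    have hobs : ∀ ζ : ↥Λ → G, obsReal Λ f ζ = ((f (glueWith Λ ζ σ) : ℝ) : ℂ) := fun ζ => by
      unfold obsReal
      congr 1
      refine hf.1 fun e he => ?_
      have he' : e ∈ cellEdges w 0 := he
      rw [glueWith_apply_mem _ _ _ (hΛ0 e he'), glueWith_apply_mem _ _ _ (hΛ0 e he')]
    rw [integral_ymSpecification_of_continuous ρ hρ β Λ hf.2.1 σ, Complex.ofReal_div]
    show _ = pertNum _ _ _ _ / pertZ _ _ _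
    unfold pertNum pertZ
    congr 1
    · rw [← integral_complex_ofReal]
      congr 1
      funext ζ
      rw [hobs, prod_one_add_cellFactor]
      push_cast
      ring
    · rw [← integral_complex_ofReal]
      congr 1
      funext ζ
      rw [prod_one_add_cellFactor]

/-! ## §5 The calibration theorems -/

omit hw

/-- **CALIBRATION: strong coupling BEFORE blocking instantiates the class at mesh `1`.**  For every compact `G`,
continuous `ρ` and radius `a > 0` there is `β_B > 0` such that for `|β| ≤ β_B` the ACTUAL Wilson kernels are in the
blocked-activity class `BlockedActivityClass ρ β 1 n a` at every window `n` (reference = product Haar, cells = the mesh-1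
frame cells owning their plaquettes, cell factors `∏ e^{-β s_p} − 1` of size `≤ 2 · cellPlaqBound · |β| (N + C_ρ) ≤ a`). -/
theorem blockedActivityClass_one_of_smallBeta (hρ : Continuous ρ) {a : ℝ} (ha : 0 < a) :
    ∃ β_B : ℝ, 0 < β_B ∧ ∀ β : ℝ, |β| ≤ β_B → ∀ n : ℕ, BlockedActivityClass ρ β 1 n a := by
  obtain ⟨C, hC0, hC⟩ := exists_forall_abs_plaquetteObs_le (d := 4) ρ hρ
  set A : ℝ := min 1 (a / 2) with hAdef
  have hA0 : 0 < A := lt_min one_pos (by linarith)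
  have hA1 : A ≤ 1 := min_le_left _ _
  have hAa : 2 * A ≤ a := by have := min_le_right 1 (a / 2); linarith
  set K : ℝ := (cellPlaqBound : ℝ) * ((N : ℝ) + C) with hKdef
  have hK0 : 0 ≤ K := by positivity
  refine ⟨A / (K + 1), div_pos hA0 (by linarith), fun β hβ n w hw Y _ h0 => ?_⟩
  have hβA : (cellPlaqBound : ℝ) * (|β| * ((N : ℝ) + C)) ≤ A := by
    have h1 : (cellPlaqBound : ℝ) * (|β| * ((N : ℝ) + C)) = K * |β| := by rw [hKdef]; ring
    rw [h1]
    calc K * |β| ≤ K * (A / (K + 1)) := mul_le_mul_of_nonneg_left hβ hK0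
      _ = A * (K / (K + 1)) := by ring
      _ ≤ A * 1 := mul_le_mul_of_nonneg_left ((div_le_one (by linarith)).2 (by linarith)) hA0.le
      _ = A := mul_one A
  exact nonempty_blockedRep ρ β hw hρ hC hβA hA1 hAa Y h0

/-- **Strong coupling, EVERY window.**  For every compact `G`, continuous `ρ` and `0 < ε ≤ 1` there is `β_B > 0` such that
`OnsetFormats.UnivShellCond ρ β 1 n ε` for all `|β| ≤ β_B` and every window `n` (class at radius `a(ε)` + the lane's
Kotecký–Preiss reduction; the case `n = 1` is the lead's `Calibration.univShellCond_one_one_of_smallBeta`). -/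
theorem univShellCond_one_of_smallBeta_allWindows (hρ : Continuous ρ) {ε : ℝ} (hε : 0 < ε) (hε1 : ε ≤ 1) :
    ∃ β_B : ℝ, 0 < β_B ∧ ∀ β : ℝ, |β| ≤ β_B → ∀ n : ℕ, UnivShellCond ρ β 1 n ε := by
  obtain ⟨β_B, hB, h⟩ := blockedActivityClass_one_of_smallBeta ρ hρ (radius_pos hε)
  exact ⟨β_B, hB, fun β hβ n => univShellCond_of_blockedActivity_radius (h β hβ n) hε1 le_rfl⟩


end Construction

/-! ## §6 The located number of the reduction (owner R98 (1)) -/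

/-- **THE NUMBER of lane B's reduction.**  `radius ε = ε ∕ (4e · 2⁸¹ · (2e)⁸²)` is the activity radius the weak side must
deliver PER CELL, in the `Δ = 81` Dobrushin-exclusion currency of `univShellCond_of_blockedActivity_radius`.  Anatomy of the
denominator (tree `norm_pertExpect_sub_integral_le'`, `B = #S = 1`): `4` = two exterior data × the bound's `2`;
`e · 2⁸¹ = e · 2^Δ` = the Peierls counting of the seeded cell sets at `x = 2^{-Δ}`; `(2e)⁸² = (2e)^{(Δ+1)·#S}` = the
DOBRUSHIN-EXCLUSION WASTE (the termwise cost of freezing the `≤ Δ + 1` cells around the observable).  A Kotecký–Preiss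
pinned-cluster bound over the SAME `pertExpect` format (tree `sum_norm_truncatedWeight_touching_le`: pinned cluster sums
`≤ #X (Δ+1) 2e ε`) should replace `2^Δ (2e)^{Δ+1}` by `O(Δ)`; not done here. -/
theorem radius_eq (ε : ℝ) : radius ε = ε / (4 * Real.exp 1 * 2 ^ 81 * (2 * Real.exp 1) ^ 82) := rfl

/-- Certified decimal enclosure of the denominator: `10⁸⁵ < 4e · 2⁸¹ · (2e)⁸² < 10⁸⁶` (`e ∈ (2.71, 2.72)`). -/
theorem radiusDen_bounds : (10 : ℝ) ^ 85 < radiusDen ∧ radiusDen < (10 : ℝ) ^ 86 := by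
  have h1 : (2.71 : ℝ) < Real.exp 1 := by
    have := Real.exp_one_gt_d9; linarith
  have h2 : Real.exp 1 < (2.72 : ℝ) := by
    have := Real.exp_one_lt_d9; linarith
  have he0 : 0 < Real.exp 1 := Real.exp_pos 1
  unfold radiusDen
  constructor
  · have hP : (2 * 2.71 : ℝ) ^ 82 < (2 * Real.exp 1) ^ 82 := by
      apply pow_lt_pow_left₀ (by linarith) (by norm_num) (by norm_num)
    calc (10 : ℝ) ^ 85 < 4 * 2.71 * 2 ^ 81 * (2 * 2.71) ^ 82 := by norm_num
      _ < 4 * Real.exp 1 * 2 ^ 81 * (2 * Real.exp 1) ^ 82 := by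
          have h3 : 4 * (2.71 : ℝ) * 2 ^ 81 < 4 * Real.exp 1 * 2 ^ 81 := by nlinarith
          have h4 : (0 : ℝ) < (2 * 2.71) ^ 82 := by positivity
          nlinarith
  · have hP : (2 * Real.exp 1) ^ 82 < (2 * 2.72 : ℝ) ^ 82 := by
      apply pow_lt_pow_left₀ (by linarith) (by positivity) (by norm_num)
    calc 4 * Real.exp 1 * 2 ^ 81 * (2 * Real.exp 1) ^ 82 < 4 * 2.72 * 2 ^ 81 * (2 * 2.72 : ℝ) ^ 82 := by
          have h3 : 4 * Real.exp 1 * 2 ^ 81 < 4 * (2.72 : ℝ) * 2 ^ 81 := by nlinarith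
          have h4 : (0 : ℝ) < (2 * Real.exp 1) ^ 82 := by positivity
          nlinarith
      _ < (10 : ℝ) ^ 86 := by norm_num

/-- Hence `ε · 10⁻⁸⁶ < radius ε < ε · 10⁻⁸⁵` for `ε > 0` (at the bootstrap accuracy `ε = 1/3552`: `radius ε ≈ 1.4 · 10⁻⁸⁹`). -/
theorem radius_bounds {ε : ℝ} (hε : 0 < ε) : ε / 10 ^ 86 < radius ε ∧ radius ε < ε / 10 ^ 85 := by
  obtain ⟨hlo, hhi⟩ := radiusDen_bounds
  unfold radius
  exact ⟨div_lt_div_of_pos_left hε radiusDen_pos hhi, div_lt_div_of_pos_left hε (by positivity) hlo⟩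

end Summit.QuantumFields.YangMills.Cruxes.IR.BlockedActivity

end
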